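import Summits.QuantumFields.BalabanUV.T4Continuum.Support.ShellMeasureLandauPinnedEndRay
import Summits.QuantumFields.BalabanUV.T4Continuum.Support.ShellMeasureLandauHolonomyStokes

/-!
# `T4Continuum.ShellMeasureLandauEndRayStokes` — row S76 «END-II-final»: row S70's 𝓔-binder ENDs (f4a three-sided, f4b §1
# print-numbers) with the classifier's (AN-bound) IN THE STOKES CURRENCY (row S73), and the LIVE-LEVEL form `P_w := ∅`
(cell `pub-balaban`, sub-cell `t4`, spine estimate NE7c (node U5b); NE7c ROUND-2 crew, unit
`b2b-balaban-t4-ne7c-formalise-leaf-04` gen 6; owner table `t4/b2b-balaban-t4-ne7c-p1/LEAVES-NE7c-P1.md` row **S76** (cut in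
RULING R-ne7cp1-g31-2, journal l.17095; CLAIM l.17142, SHAPES l.17221); ADDITIVE — imports S70 f4b
`ShellMeasureLandauPinnedEndRay` (leaf-01-g6; hence f4a and the LD chain) and S73 `ShellMeasureLandauHolonomyStokes`
(leaf-05-g7) ONLY; §1∕§2 are f4a's ∕ f4b §1's scripts VERBATIM with ONE call swapped
(`hAN_landau_chartRay ↦ hAN_landau_chartRay_stokes`); nothing of either row is restated; [folklore]; 0 `def`,
0 `def … : Prop`, 0 sorry, 0 citation tags)

HONEST FRAMING.  Finite four-torus programme, rung (B)+1 only — NOT infinite volume, NOT a mass gap, NOT the Clay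
problem, NOT summit progress; (B), `BetaPertHyp`, (B^μ) not consumed.  NE7c (`T4IndicatorShell.ShellWeightBound`) is
NOT PRINTED and NOT PROVED; «NE7c ⇐ the named binders»; (M1) realized ≠ NE7c (c3).  Nothing printed is asserted: the
equation numbers in the binder comments LOCATE displayed SHAPES ((P2), (P4), (118)∕(121), (103), (75), (44), (46), (54),
(1.27), p. 295, p. 286; B11 (19)∕(25)∕(37) for the curl read-out), they are not citations.  HONEST DEPENDENCY (cell):
continuum YM on T⁴ ⇐ BetaPertH ∧ nine spine estimates (0/9 proved); BetaPertH ⇐ (D1) ∧ (D4) ∧ CAP+tail; G-an2-4 gates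
asym, D1 and NE2/3/4.

WHY (F-ne7cp1-g31-1, GAPS l.25753; R-ne7cp1-g31-1∕-2): the letter-wise `H_AN = e^{m·κ_r·z̄} − 1 ∝ η_j` is not
inhabitable against `θ_j ∝ η_j²` at a live level (S72 `letterwise_hSM_fails`), the Stokes `κ_c·z̄ + expTail₂(m·κ_r·z̄)` is
(S73 `hSM_of_stokes`); S70 f4a∕f4b hard-wire the letter-wise `H` in `hSM` — here `hSM` is the Stokes one, `hAN` is S73's.
* §1 **`slotAC_realized_su2_landauChart_threeSided_rayE_stokes`** — f4a's three-sided END, `P_w` a parameter;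
* §2 **`slotAC_realized_su2_landauChart_print_rayE_stokes`** — f4b §1's print-numbers END on `M_n(ℂ)`, `hfin` DERIVED;
* §3 **`slotAC_realized_su2_landauChart_print_rayE_stokes_live`** — §2 at `P_w := ∅`: sections = co-test × `e^{−𝓔}`, the
  WHOLE sectioned action in the ONE binder pair `hE`∕`hB𝓔` (suppliers S74 `hE_landau_wilsonSquares` ⊕ S71 f2
  `hE_landau_chartRay_pinned` through S74 `hE_add`), slot constant **`2(m₀ + B𝓔)∕(1−δ)`** — NO words budget (S72
  `action_empty`), UNPINNED (R-2: the pin lives inside the `hE` suppliers).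
NOT HERE: [dict] (node O); the pinned ENDs stay OF RECORD (S70 f3∕f4b §2).  No estimate of Bałaban's is discharged.
-/

noncomputable section

open Set Metric NormedSpace MeasureTheory Function

namespace Summit.QuantumFields.BalabanUV.T4Continuum.ShellMeasureLandauEndRayStokes

open scoped ENNReal
open Literature.MathematicalPhysics.QuantumFieldTheory.Balaban1983to89
open B11Prop6Scheme (Prop4Hyp)
open GaugeField (GaugeInvariant)
open T4ShellMeasure (SlotAntiConcentration)
open T4CubePoincare (cube)
open T4CubeChartGnomonic (SU2)
open T4CubeChartExp (expJac expWindowDensity expFibreChart)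
open T4ShellMeasureDet (blockLaw)
open T4TreeGaugeFixing (NoClosedLoop fixTo measurable_fixTo)
open ShellMeasureWilsonTrace (TraceData)
open ShellMeasureWilsonBlock (matrixTrace matrixTrace_N_pos)
open ShellMeasureLevelAssembly (classifier weight action)
open ShellMeasureLandauHolonomy (solAt landauExp)
open ShellMeasureLandauHolonomyChart (holOf holOf_apply cplx)
open ShellMeasureLandauHolonomySkew (readOutReal isClosed_readOutReal hℓr_matrix_readOutReal)
open ShellMeasureLandauHolonomyPrint (hfin_of_cubeBound chartCube_subset_closedBall norm_wordExp_le_one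
  weight_le_of_bounds)
open ShellMeasureLandauPrinted (scheme_numbers_of_printed sectC_numbers_of_printed)
open ShellMeasureWindowBall (window_of_ballSupport)
open ShellMeasureLandauLocalEndRay (slotAC_realized_su2_landauChart_threeSided_rayE)
open ShellMeasureLandauHolonomyReal (landauField_mem_real)

open T4ShellMeasurePlaquette (expTail₂)
open ShellMeasureLandauHolonomyContinuity (continuousOn_landauHol_chartRay)
open ShellMeasureLandauHolonomyClamp (slotAC_realized_su2_of_levelData_cube_contOn)
open ShellMeasureLandauWeightLocal (hGW_landau_chartRay_local)
open ShellMeasureLandauHolonomyStokes (hAN_landau_chartRay_stokes)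
open ShellMeasureWilsonSquare (action_empty)

/-! ## §1 The three-sided 𝓔-binder END, Stokes currency -/

section EndThreeRayStokes

variable {𝒴 𝒴' 𝒳 𝒵 ℬ : Type*} [NormedAddCommGroup 𝒴] [NormedSpace ℂ 𝒴] [CompleteSpace 𝒴]
  [NormedAddCommGroup 𝒴'] [NormedSpace ℂ 𝒴'] [NormedAddCommGroup 𝒳] [NormedSpace ℂ 𝒳] [CompleteSpace 𝒳]
  [NormedAddCommGroup 𝒵] [NormedSpace ℂ 𝒵] [NormedAddCommGroup ℬ] [NormedSpace ℂ ℬ]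

variable {P : Params} {j : ℕ} [DecidableEq (PBond P j)]
variable {A : Type*} [NormedRing A] [NormedAlgebra ℂ A] [CompleteSpace A] [NormOneClass A]

/-- **THE THREE-SIDED 𝓔-BINDER END, CLASSIFIER (AN-bound) IN THE STOKES CURRENCY** — S70 f4a
`ShellMeasureLandauLocalEndRay.slotAC_realized_su2_landauChart_threeSided_rayE` VERBATIM except (i) the curl read-out
binder `hcurl : ∀ p ∈ P_u, ∀ Y, ‖((ℓs p).map (· Y)).sum‖ ≤ κ_c‖Y‖` (`0 ≤ κ_c`), (ii) `hSM` with the Stokes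
`H_AN = κ_c·z̄ + expTail₂(m·κ_r·z̄)`, `z̄ = (ε₄ + B₀b) + 4C₂B₀(ε₄ + B₀b)²`, (iii) `hAN` from S73 `hAN_landau_chartRay_stokes`.
`P_w`, the per-plaquette weight words, the real structure, `𝓔`∕`hE`∕`hB𝓔` stay parameters (live level: §3; level 0: the
block's plaquettes); the scheme tuple is the LOCALIZED one, flat norms (R-ne7cp1-g31-2).  A junction; CONDITIONAL on
every binder; nothing PRINTED is asserted; NOT Bałaban's minimiser; (M1) realized ≠ NE7c. [folklore] -/
theorem slotAC_realized_su2_landauChart_threeSided_rayE_stokes {T : Finset (PBond P j)} (hT : NoClosedLoop T)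
    (U₀ : GaugeField P j SU2) (Λ : Finset (PBond P j)) {n : ℕ} (e : ↥Λ × Fin 3 ≃ Fin n)
    {S : ℝ} (hS : 0 < S) (hSπ : 3 * S ^ 2 < Real.pi ^ 2) (c : GaugeField P j SU2 → GaugeField P j SU2)
    {R : GaugeField P j SU2 → (↥Λ → SU2) → ℝ≥0∞} (hR : ∀ V, Measurable (R V))
    {F : GaugeField P j SU2 → ℝ≥0∞} (hF : Measurable F) (hFi : GaugeInvariant F)
    (hFw : ∀ V y, F (fixTo T U₀ (updateFinset V Λ y)) =
      ENNReal.ofReal (expWindowDensity Λ (c V) S (updateFinset (c V) Λ y)) * R V y)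
    (hfin : ∀ V, ((blockLaw Λ).withDensity fun y => F (fixTo T U₀ (updateFinset V Λ y))) univ ≠ ∞)
    {u : GaugeField P j SU2 → ℝ} (hu : Measurable u) (hui : GaugeInvariant u)
    -- level data per exterior section: trace datum, plaquette index sets, window, co-test
    (Ttr : TraceData A) (hN : 0 < Ttr.N) {ι κ : Type*} {Pu : Finset ι} (hPu : Pu.Nonempty) (Pw : Finset κ)
    (W : GaugeField P j SU2 → Set (Fin n → ℝ)) (Jco : GaugeField P j SU2 → (Fin n → ℝ) → ℝ≥0∞)
    {θ δ ρ β : ℝ}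
    -- THE SCHEME DATA per exterior section (S22: (P2), (P4), (118)/(121), (103), (75), (44), scaling, (46), (54))
    (𝒢 : GaugeField P j SU2 → (𝒵 →L[ℂ] 𝒴)) (W𝒱 : GaugeField P j SU2 → 𝒴 → 𝒵) {B₀ C₄ a₃ b ε₄ : ℝ}
    (h𝒢 : ∀ V f, ‖𝒢 V f‖ ≤ B₀ * ‖f‖) (hW : ∀ V, Prop4Hyp (W𝒱 V) C₄ a₃) (hB₀ : 0 < B₀) (hC₄ : 0 ≤ C₄)
    (hε₄ : 0 ≤ ε₄) (hdom : 2 * (ε₄ + B₀ * b) ≤ a₃) (hself : B₀ * C₄ * (ε₄ + B₀ * b) ^ 2 ≤ ε₄)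
    (hcontr : 4 * B₀ * C₄ * (ε₄ + B₀ * b) < 1)
    (H₁ : GaugeField P j SU2 → (ℬ →L[ℂ] 𝒴)) (hH₁ : ∀ V B, ‖H₁ V B‖ ≤ B₀ * ‖B‖)
    (Φ : GaugeField P j SU2 → (Fin n → ℂ) → ℬ) {rΦ : ℝ} (hΦd : ∀ V, DifferentiableOn ℂ (Φ V) (ball 0 rΦ))
    (hΦ0 : ∀ V, Φ V 0 = 0) (hΦ : ∀ V, ∀ z ∈ ball (0 : Fin n → ℂ) rΦ, ‖Φ V z‖ < b) (hSr : S < rΦ)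
    (Cf : GaugeField P j SU2 → 𝒴' → 𝒳) {C₂ RC : ℝ} (hC₂ : 0 ≤ C₂)
    (hCq : ∀ V, ∀ Z : 𝒴', ‖Z‖ < RC → ‖Cf V Z‖ ≤ C₂ * ‖Z‖ ^ 2) (hCd : ∀ V, DifferentiableOn ℂ (Cf V) (ball 0 RC))
    (ιs : GaugeField P j SU2 → (𝒴 →L[ℂ] 𝒴')) (hι : ∀ V Y, ‖ιs V Y‖ ≤ ‖Y‖)
    (Hop : GaugeField P j SU2 → (𝒳 →L[ℂ] 𝒴)) (hH : ∀ V X, ‖Hop V X‖ ≤ B₀ * ‖X‖)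
    (hq : 9 * C₂ * B₀ * (ε₄ + B₀ * b) < 1) (hRC : 3 * (ε₄ + B₀ * b) ≤ RC)
    -- the classifier read-outs (7″), the weight read-outs (file (B)), the per-term functionals (LD f4)
    (ℓs : ι → List (𝒴 →L[ℂ] A)) {κr : ℝ} (hκ : 0 ≤ κr) (hℓ : ∀ p ∈ Pu, ∀ ℓ ∈ ℓs p, ∀ Y, ‖ℓ Y‖ ≤ κr * ‖Y‖)
    {m : ℕ} (hlen : ∀ p ∈ Pu, (ℓs p).length ≤ m)
    -- F-ne7cp1-g31-1 (A) ∕ row S73: ONE MORE DISPLAYED read-out binder — the CURL read-out norm of the classifier plaquettes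
    {κc : ℝ} (hκc : 0 ≤ κc) (hcurl : ∀ p ∈ Pu, ∀ Y, ‖((ℓs p).map fun ℓ => ℓ Y).sum‖ ≤ κc * ‖Y‖)
    (ℓw : κ → List (𝒴 →L[ℂ] A)) {κw : κ → ℝ} (hκw : ∀ p ∈ Pw, 0 ≤ κw p)
    (hℓw : ∀ p ∈ Pw, ∀ ℓ ∈ ℓw p, ∀ Y, ‖ℓ Y‖ ≤ κw p * ‖Y‖)
    {mw : ℕ} (hlenw : ∀ p ∈ Pw, (ℓw p).length ≤ mw)
    -- THE NON-WILSON PART AS A BINDER: any functional with its 𝓔-RAY PAIR (the slot S71's located supplier fills)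
    (𝓔 : GaugeField P j SU2 → (Fin n → ℝ) → ℝ) {B𝓔 : ℝ}
    (hE : ∀ V, ∀ x ∈ W V, ∀ c' : ℝ, 1 / 2 ≤ c' → c' ≤ 1 → 𝓔 V (c' • x) ≤ 𝓔 V x + (1 - c') * B𝓔) (hB𝓔 : 0 ≤ B𝓔)
    -- THE REAL STRUCTURE (file (A)) and the UNITARITY TYPE of the weight read-outs
    (𝓡𝒴 : AddSubgroup 𝒴) (h𝓡𝒴 : IsClosed (𝓡𝒴 : Set 𝒴)) (𝓡𝒵 : AddSubgroup 𝒵) (𝓡𝒴' : AddSubgroup 𝒴')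
    (𝓡𝒳 : AddSubgroup 𝒳) (h𝓡𝒳 : IsClosed (𝓡𝒳 : Set 𝒳)) (𝓡ℬ : AddSubgroup ℬ)
    (h𝒢r : ∀ V, ∀ f ∈ 𝓡𝒵, 𝒢 V f ∈ 𝓡𝒴) (hWr : ∀ V, ∀ Y ∈ 𝓡𝒴, W𝒱 V Y ∈ 𝓡𝒵)
    (hιr : ∀ V, ∀ Y ∈ 𝓡𝒴, ιs V Y ∈ 𝓡𝒴') (hHr : ∀ V, ∀ X ∈ 𝓡𝒳, Hop V X ∈ 𝓡𝒴)
    (hCr : ∀ V, ∀ Z ∈ 𝓡𝒴', Cf V Z ∈ 𝓡𝒳) (hH₁r : ∀ V, ∀ B ∈ 𝓡ℬ, H₁ V B ∈ 𝓡𝒴)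
    (hΦr : ∀ V, ∀ y : Fin n → ℝ, ‖y‖ ≤ S → Φ V (cplx y) ∈ 𝓡ℬ)
    (hℓr : ∀ p ∈ Pw, ∀ ℓ ∈ ℓw p, ∀ Y ∈ 𝓡𝒴, Ttr.τ (ℓ Y) = 0 ∧ ‖exp (ℓ Y)‖ ≤ 1)
    -- DICTIONARY (on the chart cube only): the block weight with the DEFINED weight words and non-Wilson term, the
    -- tested variable with the DEFINED classifier holonomies — all read-outs/terms of the SAME exponent field
    (hRdict : ∀ V, ∀ x ∈ cube n S,
      R V (expFibreChart Λ (c V) e x) = Jco V x * weight Ttr β Pw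
        (fun p => holOf (ℓw p) (fun y => landauExp (Cf V) (ιs V) (Hop V) (4 * C₂ * (ε₄ + B₀ * b) ^ 2)
          (solAt (𝒢 V) 0 (W𝒱 V) ε₄ (0 : 𝒵) (H₁ V (Φ V (cplx y))) + H₁ V (Φ V (cplx y)))))
        (𝓔 V) x)
    (hudict : ∀ V, ∀ x ∈ cube n S,
      u (fixTo T U₀ (updateFinset V Λ (expFibreChart Λ (c V) e x))) =
        classifier hPu (fun p => holOf (ℓs p) (fun y => landauExp (Cf V) (ιs V) (Hop V)
          (4 * C₂ * (ε₄ + B₀ * b) ^ 2)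
          (solAt (𝒢 V) 0 (W𝒱 V) ε₄ (0 : 𝒵) (H₁ V (Φ V (cplx y))) + H₁ V (Φ V (cplx y))))) x)
    -- SM-L5/L6: kept co-tests supported in the window, centre-monotone; the window inside the chart ball
    (hJW : ∀ V x, Jco V x ≠ 0 → x ∈ W V)
    (hJ : ∀ V x, ∀ a : ℝ, 0 ≤ a → Jco V x ≤ Jco V (Real.exp (-a) • x))
    (hWS : ∀ V, W V ⊆ closedBall (0 : Fin n → ℝ) S)
    -- numbers + the weight-side smallness `s̄ ≤ 1` + SM-L2 (SM) in the currency `Rad = r_Φ / S`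
    (hθ : 0 < θ) (hδ0 : 0 ≤ δ) (hδ1 : δ < 1) (hρ0 : 0 ≤ ρ) (hρ : ρ ≤ (1 - δ) / 2) (hβ : 0 ≤ β)
    (hsw1 : ∀ p ∈ Pw, mw * (κw p * ((ε₄ + B₀ * b) + B₀ * (4 * C₂ * (ε₄ + B₀ * b) ^ 2))) ≤ 1)
    -- SM-L2 (SM) IN THE STOKES CURRENCY: `H_AN = κ_c·z̄ + expTail₂(m·κ_r·z̄)` (S73), NOT the letter-wise `e^{mκ_r z̄} − 1`
    (hSM : 36 * (κc * ((ε₄ + B₀ * b) + B₀ * (4 * C₂ * (ε₄ + B₀ * b) ^ 2)) +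
      expTail₂ (m * (κr * ((ε₄ + B₀ * b) + B₀ * (4 * C₂ * (ε₄ + B₀ * b) ^ 2))))) * 1 ^ 2 /
      (rΦ / S - 1) ^ 2 ≤ δ * θ) :
    SlotAntiConcentration ((fieldMeasure P j SU2).withDensity F) u θ ρ
      (2 * ((n : ℝ) + (β * ∑ p ∈ Pw,
        (mw * (3 * (κw p * ((ε₄ + B₀ * b) + B₀ * (4 * C₂ * (ε₄ + B₀ * b) ^ 2))) / (rΦ / S - 1))) *
          (0 + 4 * (mw * (κw p * ((ε₄ + B₀ * b) + B₀ * (4 * C₂ * (ε₄ + B₀ * b) ^ 2))))) +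
        B𝓔)) / (1 - δ)) := by
  have hRad : 1 < rΦ / S := by rw [lt_div_iff₀ hS]; linarith
  have hb : 0 < b := by
    obtain ⟨V⟩ : Nonempty (GaugeField P j SU2) := ⟨fun _ => 1⟩
    exact (norm_nonneg _).trans_lt (hΦ V 0 (mem_ball_self (hS.trans hSr)))
  have hz : 0 < (ε₄ + B₀ * b) + B₀ * (4 * C₂ * (ε₄ + B₀ * b) ^ 2) := by positivity
  have hs0 : ∀ p ∈ Pw, 0 ≤ mw * (κw p * ((ε₄ + B₀ * b) + B₀ * (4 * C₂ * (ε₄ + B₀ * b) ^ 2))) :=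
    fun p hp => mul_nonneg (Nat.cast_nonneg _) (mul_nonneg (hκw p hp) hz.le)
  have hL0 : ∀ p ∈ Pw, 0 ≤ mw * (3 * (κw p * ((ε₄ + B₀ * b) + B₀ * (4 * C₂ * (ε₄ + B₀ * b) ^ 2))) / (rΦ / S - 1)) :=
    fun p hp => mul_nonneg (Nat.cast_nonneg _) (div_nonneg (mul_nonneg (by norm_num)
      (mul_nonneg (hκw p hp) hz.le)) (by linarith))
  refine slotAC_realized_su2_of_levelData_cube_contOn hT U₀ Λ e hS hSπ c hR hF hFi hFw hfin hu hui Ttr hN hPu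
    (fun V p => holOf (ℓs p) (fun y => landauExp (Cf V) (ιs V) (Hop V) (4 * C₂ * (ε₄ + B₀ * b) ^ 2)
      (solAt (𝒢 V) 0 (W𝒱 V) ε₄ (0 : 𝒵) (H₁ V (Φ V (cplx y))) + H₁ V (Φ V (cplx y)))))
    (fun V p _ => continuousOn_landauHol_chartRay hS (h𝒢 V) (hW V) hB₀ hC₄ hε₄ hdom hself hcontr (H₁ V) (hH₁ V)
      (hΦd V) (hΦ V) hSr hC₂ (hCq V) (hCd V) (ιs V) (hι V) (Hop V) (hH V) hq hRC (ℓs p))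
    Pw
    (fun V p => holOf (ℓw p) (fun y => landauExp (Cf V) (ιs V) (Hop V) (4 * C₂ * (ε₄ + B₀ * b) ^ 2)
      (solAt (𝒢 V) 0 (W𝒱 V) ε₄ (0 : 𝒵) (H₁ V (Φ V (cplx y))) + H₁ V (Φ V (cplx y)))))
    𝓔 W Jco
    (sw := fun p => mw * (κw p * ((ε₄ + B₀ * b) + B₀ * (4 * C₂ * (ε₄ + B₀ * b) ^ 2))))
    (lw := fun p => mw * (3 * (κw p * ((ε₄ + B₀ * b) + B₀ * (4 * C₂ * (ε₄ + B₀ * b) ^ 2))) / (rΦ / S - 1)))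
    (dw := fun _ => 0)
    hRdict hudict hJW hJ hRad (fun V => ?_) (fun V => ?_) hsw1 hs0 hL0
    (fun _ _ => le_rfl) hE hB𝓔 hθ hδ0 hδ1 hρ0 hρ hβ hSM
  · -- THE ONE CHANGED CALL: the classifier's (AN-bound) in the STOKES currency (row S73)
    exact hAN_landau_chartRay_stokes hS (hWS V) (h𝒢 V) (hW V) hB₀ hC₄ hε₄ hdom hself hcontr (H₁ V) (hH₁ V) (hΦd V)
      (hΦ0 V) (hΦ V) hSr hC₂ (hCq V) (hCd V) (ιs V) (hι V) (Hop V) (hH V) hq hRC ℓs hκ hℓ hκc hcurl hlen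
  · exact hGW_landau_chartRay_local Ttr hS (hWS V) (h𝒢 V) (hW V) hB₀ hC₄ hε₄ hdom hself hcontr (H₁ V) (hH₁ V)
      (hΦd V) (hΦ0 V) (hΦ V) hSr hC₂ (hCq V) (hCd V) (ιs V) (hι V) (Hop V) (hH V) hq hRC ℓw hκw hℓw hlenw 𝓡𝒴 h𝓡𝒴
      𝓡𝒵 𝓡𝒴' 𝓡𝒳 h𝓡𝒳 𝓡ℬ (h𝒢r V) (hWr V) (hιr V) (hHr V) (hCr V) (hH₁r V) (hΦr V) hℓr

end EndThreeRayStokes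

/-! ## §2 The print-numbers 𝓔-binder END on `M_n(ℂ)`, Stokes currency -/

section EndPrintStokes

open scoped Matrix.Norms.L2Operator

variable {P : Params} {j : ℕ} [DecidableEq (PBond P j)]
variable {n : Type*} [Fintype n] [DecidableEq n] [Nonempty n]
variable {𝒴 𝒴' 𝒳 𝒵 ℬ : Type*} [NormedAddCommGroup 𝒴] [NormedSpace ℂ 𝒴] [CompleteSpace 𝒴]
  [NormedAddCommGroup 𝒴'] [NormedSpace ℂ 𝒴'] [NormedAddCommGroup 𝒳] [NormedSpace ℂ 𝒳] [CompleteSpace 𝒳]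
  [NormedAddCommGroup 𝒵] [NormedSpace ℂ 𝒵] [NormedAddCommGroup ℬ] [NormedSpace ℂ ℬ]

/-- **THE PRINT-NUMBERS 𝓔-BINDER END, STOKES CURRENCY** — S70 f4b §1 `…PinnedEndRay.slotAC_realized_su2_landauChart_print_rayE`
VERBATIM (printed smallness ⇒ scheme numerics, (1.27) ball support ⇒ window, `hfin` DERIVED from `Jco ≤ 1` + the words'
unitarity + `h𝓔lb`) except §1's two Stokes changes (`hcurl`, `hSM` with `H_AN = κ_c·z̄ + expTail₂(m·κ_r·z̄)`,
`z̄ = (ε₄ + 2B₀dLC₁ε₁) + …`); UNPINNED; CONDITIONAL on every binder; nothing PRINTED asserted; (M1) realized ≠ NE7c. [folklore] -/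
theorem slotAC_realized_su2_landauChart_print_rayE_stokes {T : Finset (PBond P j)} (hT : NoClosedLoop T)
    (U₀ : GaugeField P j SU2) (Λ : Finset (PBond P j)) {m₀ : ℕ} (e : ↥Λ × Fin 3 ≃ Fin m₀)
    {S : ℝ} (hS : 0 < S) (hSπ : 3 * S ^ 2 < Real.pi ^ 2) (c : GaugeField P j SU2 → GaugeField P j SU2)
    {F : GaugeField P j SU2 → ℝ≥0∞} (hF : Measurable F) (hFi : GaugeInvariant F)
    -- print's (1.27) window as a SUPPORT property of the `T`-gauged sections (S20)
    (hFsupp : ∀ V y, F (fixTo T U₀ (updateFinset V Λ y)) ≠ 0 →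
      ∀ b (hb : b ∈ Λ), dist1 ((c V b)⁻¹ * y ⟨b, hb⟩) ≤ 2 * Real.sin (S / 2))
    {u : GaugeField P j SU2 → ℝ} (hu : Measurable u) (hui : GaugeInvariant u)
    -- plaquette index sets, window, co-test
    {ι κ : Type*} {Pu : Finset ι} (hPu : Pu.Nonempty) (Pw : Finset κ)
    (W : GaugeField P j SU2 → Set (Fin m₀ → ℝ)) (Jco : GaugeField P j SU2 → (Fin m₀ → ℝ) → ℝ≥0∞)
    {θ δ ρ β : ℝ}
    -- THE SCHEME OPERATORS per exterior section with V-uniform constants ((P2), (P4), (103), (75), (44), scaling, (46))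
    (𝒢 : GaugeField P j SU2 → (𝒵 →L[ℂ] 𝒴)) (W𝒱 : GaugeField P j SU2 → 𝒴 → 𝒵) {B₀ C₄ a₃ ε₄ : ℝ}
    (h𝒢 : ∀ V f, ‖𝒢 V f‖ ≤ B₀ * ‖f‖) (hW : ∀ V, Prop4Hyp (W𝒱 V) C₄ a₃) (hB₀ : 0 < B₀) (hC₄ : 0 ≤ C₄)
    (hε₄ : 0 ≤ ε₄)
    -- Prop. 6's PRINTED smallness (p. 295) with `dL ≤ B₃`; the coarse-field size `2dLC₁ε₁` of (75)
    {dL C₁ B₃ ε₁ : ℝ} (hdL : 0 ≤ dL) (hC₁ : 0 ≤ C₁) (hε₁ : 0 ≤ ε₁) (hB₃ : dL ≤ B₃)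
    (h1 : 2 * B₀ * C₁ * B₃ * ε₁ ≤ ε₄) (h2 : 4 * ε₄ ≤ a₃) (h3 : 16 * B₀ * C₄ * ε₄ ≤ 1)
    (H₁ : GaugeField P j SU2 → (ℬ →L[ℂ] 𝒴)) (hH₁ : ∀ V B, ‖H₁ V B‖ ≤ B₀ * ‖B‖)
    (Φ : GaugeField P j SU2 → (Fin m₀ → ℂ) → ℬ) {rΦ : ℝ} (hΦd : ∀ V, DifferentiableOn ℂ (Φ V) (ball 0 rΦ))
    (hΦ0 : ∀ V, Φ V 0 = 0) (hΦ : ∀ V, ∀ z ∈ ball (0 : Fin m₀ → ℂ) rΦ, ‖Φ V z‖ < 2 * dL * C₁ * ε₁) (hSr : S < rΦ)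
    (Cf : GaugeField P j SU2 → 𝒴' → 𝒳) {C₂ RC : ℝ} (hC₂ : 0 ≤ C₂)
    (hCq : ∀ V, ∀ Z : 𝒴', ‖Z‖ < RC → ‖Cf V Z‖ ≤ C₂ * ‖Z‖ ^ 2) (hCd : ∀ V, DifferentiableOn ℂ (Cf V) (ball 0 RC))
    (ιs : GaugeField P j SU2 → (𝒴 →L[ℂ] 𝒴')) (hι : ∀ V Y, ‖ιs V Y‖ ≤ ‖Y‖)
    (Hop : GaugeField P j SU2 → (𝒳 →L[ℂ] 𝒴)) (hH : ∀ V X, ‖Hop V X‖ ≤ B₀ * ‖X‖)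
    -- Prop. 3's PRINTED smallness (p. 286) + the located coupling into its domain and B13's domain condition
    {ε₃ : ℝ} (h18 : 18 * C₂ * B₀ * ε₃ ≤ 1) (hcoup : ε₄ + B₀ * (2 * dL * C₁ * ε₁) ≤ ε₃) (h3R : 3 * ε₃ ≤ RC)
    -- the classifier read-outs, the WEIGHT read-outs, the per-term functionals — values in `M_n(ℂ)`
    (ℓs : ι → List (𝒴 →L[ℂ] Matrix n n ℂ)) {κr : ℝ} (hκ : 0 ≤ κr)
    (hℓ : ∀ p ∈ Pu, ∀ ℓ ∈ ℓs p, ∀ Y, ‖ℓ Y‖ ≤ κr * ‖Y‖) {m : ℕ} (hlen : ∀ p ∈ Pu, (ℓs p).length ≤ m)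
    -- F-ne7cp1-g31-1 (A) ∕ row S73: the CURL read-out norm of the classifier plaquettes (DISPLAYED; `κ_c ∝ η²` at a live level)
    {κc : ℝ} (hκc : 0 ≤ κc) (hcurl : ∀ p ∈ Pu, ∀ Y, ‖((ℓs p).map fun ℓ => ℓ Y).sum‖ ≤ κc * ‖Y‖)
    (ℓw : κ → List (𝒴 →L[ℂ] Matrix n n ℂ)) {κw : κ → ℝ} (hκw : ∀ p ∈ Pw, 0 ≤ κw p)
    (hℓw : ∀ p ∈ Pw, ∀ ℓ ∈ ℓw p, ∀ Y, ‖ℓ Y‖ ≤ κw p * ‖Y‖) {mw : ℕ} (hlenw : ∀ p ∈ Pw, (ℓw p).length ≤ mw)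
    -- THE NON-WILSON PART AS A BINDER: any functional with its 𝓔-RAY PAIR (S71's located supplier fills it) and a
    -- LOWER BOUND on the chart cube (for the finiteness proviso only)
    (𝓔 : GaugeField P j SU2 → (Fin m₀ → ℝ) → ℝ) {B𝓔 B𝓔lb : ℝ}
    (hE : ∀ V, ∀ x ∈ W V, ∀ c' : ℝ, 1 / 2 ≤ c' → c' ≤ 1 → 𝓔 V (c' • x) ≤ 𝓔 V x + (1 - c') * B𝓔) (hB𝓔 : 0 ≤ B𝓔)
    (h𝓔lb : ∀ V (y : Fin m₀ → ℝ), ‖y‖ ≤ S → -B𝓔lb ≤ 𝓔 V y)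
    -- THE REAL STRUCTURE GENERATED BY A READ-OUT SET `L` containing the weight read-outs; its images; preservation
    (L : Set (𝒴 →L[ℂ] Matrix n n ℂ)) (hL : ∀ p ∈ Pw, ∀ ℓ ∈ ℓw p, ℓ ∈ L)
    (𝓡𝒵 : AddSubgroup 𝒵) (𝓡𝒴' : AddSubgroup 𝒴') (𝓡𝒳 : AddSubgroup 𝒳) (h𝓡𝒳 : IsClosed (𝓡𝒳 : Set 𝒳))
    (𝓡ℬ : AddSubgroup ℬ)
    (h𝒢r : ∀ V, ∀ f ∈ 𝓡𝒵, 𝒢 V f ∈ readOutReal L) (hWr : ∀ V, ∀ Y ∈ readOutReal L, W𝒱 V Y ∈ 𝓡𝒵)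
    (hιr : ∀ V, ∀ Y ∈ readOutReal L, ιs V Y ∈ 𝓡𝒴') (hHr : ∀ V, ∀ X ∈ 𝓡𝒳, Hop V X ∈ readOutReal L)
    (hCr : ∀ V, ∀ Z ∈ 𝓡𝒴', Cf V Z ∈ 𝓡𝒳) (hH₁r : ∀ V, ∀ B ∈ 𝓡ℬ, H₁ V B ∈ readOutReal L)
    (hΦr : ∀ V, ∀ y : Fin m₀ → ℝ, ‖y‖ ≤ S → Φ V (cplx y) ∈ 𝓡ℬ)
    -- DICTIONARY (on the chart cube only): the density's OWN sections with the DEFINED weight words and non-Wilson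
    -- term; the tested variable with the DEFINED classifier holonomies — all of the SAME exponent field
    (hRdict : ∀ V, ∀ x ∈ cube m₀ S,
      F (fixTo T U₀ (updateFinset V Λ (expFibreChart Λ (c V) e x))) = Jco V x * weight (matrixTrace (n := n)) β Pw
        (fun p => holOf (ℓw p) (fun y => landauExp (Cf V) (ιs V) (Hop V)
          (4 * C₂ * (ε₄ + B₀ * (2 * dL * C₁ * ε₁)) ^ 2)
          (solAt (𝒢 V) 0 (W𝒱 V) ε₄ (0 : 𝒵) (H₁ V (Φ V (cplx y))) + H₁ V (Φ V (cplx y)))))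
        (𝓔 V) x)
    (hudict : ∀ V, ∀ x ∈ cube m₀ S,
      u (fixTo T U₀ (updateFinset V Λ (expFibreChart Λ (c V) e x))) =
        classifier hPu (fun p => holOf (ℓs p) (fun y => landauExp (Cf V) (ιs V) (Hop V)
          (4 * C₂ * (ε₄ + B₀ * (2 * dL * C₁ * ε₁)) ^ 2)
          (solAt (𝒢 V) 0 (W𝒱 V) ε₄ (0 : 𝒵) (H₁ V (Φ V (cplx y))) + H₁ V (Φ V (cplx y))))) x)
    -- co-tests: supported in the window, centre-monotone, AT MOST ONE; the window inside the chart ball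
    (hJW : ∀ V x, Jco V x ≠ 0 → x ∈ W V)
    (hJ : ∀ V x, ∀ a : ℝ, 0 ≤ a → Jco V x ≤ Jco V (Real.exp (-a) • x))
    (hJ1 : ∀ V x, Jco V x ≤ 1)
    (hWS : ∀ V, W V ⊆ closedBall (0 : Fin m₀ → ℝ) S)
    -- numbers + the weight-side smallness + SM-L2 (SM) in the currency `Rad = r_Φ / S`
    (hθ : 0 < θ) (hδ0 : 0 ≤ δ) (hδ1 : δ < 1) (hρ0 : 0 ≤ ρ) (hρ : ρ ≤ (1 - δ) / 2) (hβ : 0 ≤ β)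
    (hsw1 : ∀ p ∈ Pw, mw * (κw p * ((ε₄ + B₀ * (2 * dL * C₁ * ε₁)) +
      B₀ * (4 * C₂ * (ε₄ + B₀ * (2 * dL * C₁ * ε₁)) ^ 2))) ≤ 1)
    -- SM-L2 (SM) IN THE STOKES CURRENCY (S73 `hSM_of_stokes` inhabits it η-free)
    (hSM : 36 * (κc * ((ε₄ + B₀ * (2 * dL * C₁ * ε₁)) + B₀ * (4 * C₂ * (ε₄ + B₀ * (2 * dL * C₁ * ε₁)) ^ 2)) +
      expTail₂ (m * (κr * ((ε₄ + B₀ * (2 * dL * C₁ * ε₁)) +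
        B₀ * (4 * C₂ * (ε₄ + B₀ * (2 * dL * C₁ * ε₁)) ^ 2))))) * 1 ^ 2 / (rΦ / S - 1) ^ 2 ≤ δ * θ) :
    SlotAntiConcentration ((fieldMeasure P j SU2).withDensity F) u θ ρ
      (2 * ((m₀ : ℝ) + (β * ∑ p ∈ Pw,
        (mw * (3 * (κw p * ((ε₄ + B₀ * (2 * dL * C₁ * ε₁)) +
          B₀ * (4 * C₂ * (ε₄ + B₀ * (2 * dL * C₁ * ε₁)) ^ 2))) / (rΦ / S - 1))) *
          (0 + 4 * (mw * (κw p * ((ε₄ + B₀ * (2 * dL * C₁ * ε₁)) +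
            B₀ * (4 * C₂ * (ε₄ + B₀ * (2 * dL * C₁ * ε₁)) ^ 2))))) +
        B𝓔)) / (1 - δ)) := by
  -- the printed smallness gives the scheme numerics ((118)/(121) at the ray; (54) at `ε₄ + 2dLB₀C₁ε₁`)
  obtain ⟨hdom, hself, hcontr, -⟩ := scheme_numbers_of_printed hdL hB₀.le hC₁ hC₄ hε₁ hε₄ hB₃ h1 h2 h3
  have hself' : B₀ * C₄ * (ε₄ + B₀ * (2 * dL * C₁ * ε₁)) ^ 2 ≤ ε₄ := by simpa using hself
  have hcontr' : 4 * B₀ * C₄ * (ε₄ + B₀ * (2 * dL * C₁ * ε₁)) < 1 := by simpa using hcontr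
  obtain ⟨hq, hRC⟩ := sectC_numbers_of_printed hC₂ hB₀.le h18 hcoup h3R
  -- (LR)_j from the ball support (S20); the block weight is the density's own section
  have hR : ∀ V, Measurable fun y : ↥Λ → SU2 => F (fixTo T U₀ (updateFinset V Λ y)) :=
    fun _ => hF.comp ((measurable_fixTo T U₀).comp measurable_updateFinset)
  have hFw := window_of_ballSupport T U₀ Λ c hS.le hFsupp
  -- the finiteness proviso: the density on the cube is co-test × a weight bounded by `e^{H̄/2}`
  have hfin : ∀ V, ((blockLaw Λ).withDensity fun y => F (fixTo T U₀ (updateFinset V Λ y))) univ ≠ ∞ := by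
    refine hfin_of_cubeBound T U₀ Λ e hS hSπ c hR hFw (K := 1 * ENNReal.ofReal (Real.exp B𝓔lb))
      (ENNReal.mul_ne_top ENNReal.one_ne_top ENNReal.ofReal_ne_top) fun V x hx => ?_
    show F (fixTo T U₀ (updateFinset V Λ (expFibreChart Λ (c V) e x))) ≤ _
    rw [hRdict V x hx]
    have hy : ‖x‖ ≤ S := mem_closedBall_zero_iff.1 (chartCube_subset_closedBall hS.le hx)
    refine mul_le_mul' (hJ1 V x)
      (weight_le_of_bounds (matrixTrace (n := n)) matrixTrace_N_pos hβ Pw (fun p hp => ?_) (h𝓔lb V x hy))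
    -- the weight words contract: the exponent field at the real point is real, the read-outs skew, the letters unitary
    rw [holOf_apply]
    refine norm_wordExp_le_one _ fun a ha => ?_
    obtain ⟨ℓ, hℓ, rfl⟩ := List.mem_map.1 ha
    have hZr := landauField_mem_real (h𝒢 V) (hW V) hB₀ hC₄ hε₄ hdom hself' hcontr' (H₁ V) (hH₁ V) (hΦ V) hSr
      hC₂ (hCq V) (hCd V) (ιs V) (hι V) (Hop V) (hH V) hq hRC (readOutReal L) (isClosed_readOutReal L) 𝓡𝒵 𝓡𝒴'
      𝓡𝒳 h𝓡𝒳 𝓡ℬ (h𝒢r V) (hWr V) (hιr V) (hHr V) (hCr V) (hH₁r V) (hΦr V) hy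
    exact (hℓr_matrix_readOutReal Pw ℓw L hL p hp ℓ hℓ _ hZr).2
  exact slotAC_realized_su2_landauChart_threeSided_rayE_stokes hT U₀ Λ e hS hSπ c hR hF hFi hFw hfin hu hui
    (matrixTrace (n := n)) matrixTrace_N_pos hPu Pw W Jco 𝒢 W𝒱 h𝒢 hW hB₀ hC₄ hε₄ hdom hself' hcontr' H₁ hH₁ Φ hΦd
    hΦ0 hΦ hSr Cf hC₂ hCq hCd ιs hι Hop hH hq hRC ℓs hκ hℓ hlen hκc hcurl ℓw hκw hℓw hlenw 𝓔 hE hB𝓔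
    (readOutReal L) (isClosed_readOutReal L) 𝓡𝒵 𝓡𝒴' 𝓡𝒳 h𝓡𝒳 𝓡ℬ h𝒢r hWr hιr hHr hCr hH₁r hΦr
    (hℓr_matrix_readOutReal Pw ℓw L hL) hRdict hudict hJW hJ hWS hθ hδ0 hδ1 hρ0 hρ hβ hsw1 hSM

/-! ## §3 END-II-final at a LIVE level: `P_w := ∅` — the whole sectioned action in `𝓔`, NO words budget -/
/-- **END-II-FINAL, LIVE-LEVEL FORM (`P_w := ∅`)** — §2 with NO weight words: the density's sections on the chart cube
read `co-test × e^{−𝓔 V x}`, `𝓔 V` the WHOLE sectioned action carried by the ONE pair `hE`∕`hB𝓔` (suppliers S74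
`hE_landau_wilsonSquares` ⊕ S71 f2 `hE_landau_chartRay_pinned` via S74 `hE_add`), `hSM` inhabited by S73 `hSM_of_stokes`;
slot constant **`2(m₀ + B𝓔)∕(1 − δ)`** — NO words budget (S72 `action_empty`); R-ne7cp1-g31-1∕-2; CONDITIONAL on every
binder; nothing PRINTED asserted; NOT Bałaban's minimiser; (M1) realized ≠ NE7c. [folklore] -/
theorem slotAC_realized_su2_landauChart_print_rayE_stokes_live {T : Finset (PBond P j)} (hT : NoClosedLoop T)
    (U₀ : GaugeField P j SU2) (Λ : Finset (PBond P j)) {m₀ : ℕ} (e : ↥Λ × Fin 3 ≃ Fin m₀)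
    {S : ℝ} (hS : 0 < S) (hSπ : 3 * S ^ 2 < Real.pi ^ 2) (c : GaugeField P j SU2 → GaugeField P j SU2)
    {F : GaugeField P j SU2 → ℝ≥0∞} (hF : Measurable F) (hFi : GaugeInvariant F)
    (hFsupp : ∀ V y, F (fixTo T U₀ (updateFinset V Λ y)) ≠ 0 →
      ∀ b (hb : b ∈ Λ), dist1 ((c V b)⁻¹ * y ⟨b, hb⟩) ≤ 2 * Real.sin (S / 2))
    {u : GaugeField P j SU2 → ℝ} (hu : Measurable u) (hui : GaugeInvariant u)
    {ι : Type*} {Pu : Finset ι} (hPu : Pu.Nonempty)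
    (W : GaugeField P j SU2 → Set (Fin m₀ → ℝ)) (Jco : GaugeField P j SU2 → (Fin m₀ → ℝ) → ℝ≥0∞)
    {θ δ ρ β : ℝ}
    (𝒢 : GaugeField P j SU2 → (𝒵 →L[ℂ] 𝒴)) (W𝒱 : GaugeField P j SU2 → 𝒴 → 𝒵) {B₀ C₄ a₃ ε₄ : ℝ}
    (h𝒢 : ∀ V f, ‖𝒢 V f‖ ≤ B₀ * ‖f‖) (hW : ∀ V, Prop4Hyp (W𝒱 V) C₄ a₃) (hB₀ : 0 < B₀) (hC₄ : 0 ≤ C₄)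
    (hε₄ : 0 ≤ ε₄)
    {dL C₁ B₃ ε₁ : ℝ} (hdL : 0 ≤ dL) (hC₁ : 0 ≤ C₁) (hε₁ : 0 ≤ ε₁) (hB₃ : dL ≤ B₃)
    (h1 : 2 * B₀ * C₁ * B₃ * ε₁ ≤ ε₄) (h2 : 4 * ε₄ ≤ a₃) (h3 : 16 * B₀ * C₄ * ε₄ ≤ 1)
    (H₁ : GaugeField P j SU2 → (ℬ →L[ℂ] 𝒴)) (hH₁ : ∀ V B, ‖H₁ V B‖ ≤ B₀ * ‖B‖)
    (Φ : GaugeField P j SU2 → (Fin m₀ → ℂ) → ℬ) {rΦ : ℝ} (hΦd : ∀ V, DifferentiableOn ℂ (Φ V) (ball 0 rΦ))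
    (hΦ0 : ∀ V, Φ V 0 = 0) (hΦ : ∀ V, ∀ z ∈ ball (0 : Fin m₀ → ℂ) rΦ, ‖Φ V z‖ < 2 * dL * C₁ * ε₁) (hSr : S < rΦ)
    (Cf : GaugeField P j SU2 → 𝒴' → 𝒳) {C₂ RC : ℝ} (hC₂ : 0 ≤ C₂)
    (hCq : ∀ V, ∀ Z : 𝒴', ‖Z‖ < RC → ‖Cf V Z‖ ≤ C₂ * ‖Z‖ ^ 2) (hCd : ∀ V, DifferentiableOn ℂ (Cf V) (ball 0 RC))
    (ιs : GaugeField P j SU2 → (𝒴 →L[ℂ] 𝒴')) (hι : ∀ V Y, ‖ιs V Y‖ ≤ ‖Y‖)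
    (Hop : GaugeField P j SU2 → (𝒳 →L[ℂ] 𝒴)) (hH : ∀ V X, ‖Hop V X‖ ≤ B₀ * ‖X‖)
    {ε₃ : ℝ} (h18 : 18 * C₂ * B₀ * ε₃ ≤ 1) (hcoup : ε₄ + B₀ * (2 * dL * C₁ * ε₁) ≤ ε₃) (h3R : 3 * ε₃ ≤ RC)
    (ℓs : ι → List (𝒴 →L[ℂ] Matrix n n ℂ)) {κr : ℝ} (hκ : 0 ≤ κr)
    (hℓ : ∀ p ∈ Pu, ∀ ℓ ∈ ℓs p, ∀ Y, ‖ℓ Y‖ ≤ κr * ‖Y‖) {m : ℕ} (hlen : ∀ p ∈ Pu, (ℓs p).length ≤ m)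
    {κc : ℝ} (hκc : 0 ≤ κc) (hcurl : ∀ p ∈ Pu, ∀ Y, ‖((ℓs p).map fun ℓ => ℓ Y).sum‖ ≤ κc * ‖Y‖)
    (𝓔 : GaugeField P j SU2 → (Fin m₀ → ℝ) → ℝ) {B𝓔 B𝓔lb : ℝ}
    (hE : ∀ V, ∀ x ∈ W V, ∀ c' : ℝ, 1 / 2 ≤ c' → c' ≤ 1 → 𝓔 V (c' • x) ≤ 𝓔 V x + (1 - c') * B𝓔) (hB𝓔 : 0 ≤ B𝓔)
    (h𝓔lb : ∀ V (y : Fin m₀ → ℝ), ‖y‖ ≤ S → -B𝓔lb ≤ 𝓔 V y)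
    (L : Set (𝒴 →L[ℂ] Matrix n n ℂ))
    (𝓡𝒵 : AddSubgroup 𝒵) (𝓡𝒴' : AddSubgroup 𝒴') (𝓡𝒳 : AddSubgroup 𝒳) (h𝓡𝒳 : IsClosed (𝓡𝒳 : Set 𝒳))
    (𝓡ℬ : AddSubgroup ℬ)
    (h𝒢r : ∀ V, ∀ f ∈ 𝓡𝒵, 𝒢 V f ∈ readOutReal L) (hWr : ∀ V, ∀ Y ∈ readOutReal L, W𝒱 V Y ∈ 𝓡𝒵)
    (hιr : ∀ V, ∀ Y ∈ readOutReal L, ιs V Y ∈ 𝓡𝒴') (hHr : ∀ V, ∀ X ∈ 𝓡𝒳, Hop V X ∈ readOutReal L)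
    (hCr : ∀ V, ∀ Z ∈ 𝓡𝒴', Cf V Z ∈ 𝓡𝒳) (hH₁r : ∀ V, ∀ B ∈ 𝓡ℬ, H₁ V B ∈ readOutReal L)
    (hΦr : ∀ V, ∀ y : Fin m₀ → ℝ, ‖y‖ ≤ S → Φ V (cplx y) ∈ 𝓡ℬ)
    (hRdict : ∀ V, ∀ x ∈ cube m₀ S,
      F (fixTo T U₀ (updateFinset V Λ (expFibreChart Λ (c V) e x))) =
        Jco V x * ENNReal.ofReal (Real.exp (-(𝓔 V x))))
    (hudict : ∀ V, ∀ x ∈ cube m₀ S,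
      u (fixTo T U₀ (updateFinset V Λ (expFibreChart Λ (c V) e x))) =
        classifier hPu (fun p => holOf (ℓs p) (fun y => landauExp (Cf V) (ιs V) (Hop V)
          (4 * C₂ * (ε₄ + B₀ * (2 * dL * C₁ * ε₁)) ^ 2)
          (solAt (𝒢 V) 0 (W𝒱 V) ε₄ (0 : 𝒵) (H₁ V (Φ V (cplx y))) + H₁ V (Φ V (cplx y))))) x)
    (hJW : ∀ V x, Jco V x ≠ 0 → x ∈ W V)
    (hJ : ∀ V x, ∀ a : ℝ, 0 ≤ a → Jco V x ≤ Jco V (Real.exp (-a) • x))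
    (hJ1 : ∀ V x, Jco V x ≤ 1)
    (hWS : ∀ V, W V ⊆ closedBall (0 : Fin m₀ → ℝ) S)
    (hθ : 0 < θ) (hδ0 : 0 ≤ δ) (hδ1 : δ < 1) (hρ0 : 0 ≤ ρ) (hρ : ρ ≤ (1 - δ) / 2) (hβ : 0 ≤ β)
    (hSM : 36 * (κc * ((ε₄ + B₀ * (2 * dL * C₁ * ε₁)) + B₀ * (4 * C₂ * (ε₄ + B₀ * (2 * dL * C₁ * ε₁)) ^ 2)) +
      expTail₂ (m * (κr * ((ε₄ + B₀ * (2 * dL * C₁ * ε₁)) +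
        B₀ * (4 * C₂ * (ε₄ + B₀ * (2 * dL * C₁ * ε₁)) ^ 2))))) * 1 ^ 2 / (rΦ / S - 1) ^ 2 ≤ δ * θ) :
    SlotAntiConcentration ((fieldMeasure P j SU2).withDensity F) u θ ρ (2 * ((m₀ : ℝ) + B𝓔) / (1 - δ)) := by
  -- §2 at `P_w := ∅` (index type `Unit`, no words): every weight-side hypothesis is vacuous, the words sum is `0`
  have h := slotAC_realized_su2_landauChart_print_rayE_stokes hT U₀ Λ e hS hSπ c hF hFi hFsupp hu hui hPu (∅ : Finset Unit)
    W Jco 𝒢 W𝒱 h𝒢 hW hB₀ hC₄ hε₄ hdL hC₁ hε₁ hB₃ h1 h2 h3 H₁ hH₁ Φ hΦd hΦ0 hΦ hSr Cf hC₂ hCq hCd ιs hι Hop hH h18 hcoup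
    h3R ℓs hκ hℓ hlen hκc hcurl (fun _ => ([] : List (𝒴 →L[ℂ] Matrix n n ℂ))) (κw := fun _ => 0)
    (fun _ h => absurd h (Finset.notMem_empty _)) (fun _ h => absurd h (Finset.notMem_empty _)) (mw := 0)
    (fun _ h => absurd h (Finset.notMem_empty _)) 𝓔 hE hB𝓔 h𝓔lb L (fun _ h => absurd h (Finset.notMem_empty _))
    𝓡𝒵 𝓡𝒴' 𝓡𝒳 h𝓡𝒳 𝓡ℬ h𝒢r hWr hιr hHr hCr hH₁r hΦr (fun V x hx => ?_) hudict hJW hJ hJ1 hWS hθ hδ0 hδ1 hρ0 hρ hβ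
    (fun _ h => absurd h (Finset.notMem_empty _)) hSM
  · simpa using h
  · -- the dictionary: `weight T β ∅ G 𝓔 = e^{−𝓔}` (S72 `action_empty`)
    rw [hRdict V x hx, weight, action_empty]

end EndPrintStokes

end Summit.QuantumFields.BalabanUV.T4Continuum.ShellMeasureLandauEndRayStokes

end
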